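import Summits.ValiantsHypothesis.ValiantsHypothesis.Theorems.LacunarySymmetroidMatrixDescartesCensusTwistSum

/-!
# `MatrixDescartes` census — the END-WINDOW («untwisting») row of a Descartes-sharp fewnomial (kernel version)

HONEST FRAMING.  Object-search cell `pub-symmetroid`, door-A item `Theses.LacunarySymmetroid.DoorA26 = PosRootLawAt 2 6 19`
(stmt-ValiantsHypothesis-19979; OPEN, typed, never asserted).  A structural row about ONE arbitrary real polynomial: the exact
form of theory g20's «input (β)» / the «END-WINDOW (untwisting) row» (RESIDUE-READING-g20 §2 (l2)–(l4), G15-HEAD W-list W6),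
valid for EVERY Descartes-sharp fewnomial — no limit or compactness argument enters.

Setting: `f` real with `#supp f ≤ #Z₊(f) + 1` (Descartes-sharp on its own support), a set `L` of LOW exponents of `f`, a window
`p < q < r` of exponents of `f` above `L`, and `U = supp f ∖ (L ∪ {p,q,r})` the exponents killed by Euler twists; write
`C_s = coeff f s · ∏_{u∈U}(s − u)` for the twisted coefficients, `κ_s = ∏_{l∈L}(s − l)`, `a = q − p`, `b = r − q`.

* `end_window_coeff` — **the end-window row**: if `C_p C_q < 0`, `C_q C_r < 0` and, for weights `w_l ≥ 0` (`l ∈ L`) with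
  `∑ w_l ≤ 1`, the monomial inequalities `|C_l|^b ((a+b)|C_r| κ_r)^{p−l} ≤ w_l^b |C_p|^b (a|C_q| κ_q)^{p−l}` hold, then
  `(a+b)^{a+b} ((1 − ∑ w_l)|C_p|)^b |C_r|^a ≤ |C_q|^{a+b} a^a b^b`.
  With `L = ∅` this is the tree's Newton-cone row C25 at `(p,q,r)` (`Census.newton_cone_coeff`, trinomial form); with `L ≠ ∅`
  the twist factors `κ` of the low exponents are ABSENT from the row (they would weaken it, `ln κ` being concave) at the price
  of `(1 − ∑ w_l)^b` — in the cell's LP currency «C25 constant + twist − b·ln(1 − θ)», `θ = ∑ w_l` certified at a node by LP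
  bounds of the scale-invariant functionals `b(x_l − x_p) + (l − p)(x_q − x_r)`.  Proof: twist away `U` (a `(#L+3)`-nomial `ψ`
  with `#L+2` roots remains), twist away `L` (a trinomial with two roots remains), take its root `τ` beyond the critical point
  (`exists_root_of_trinomial_pow_gt`), lift it to a root `ρ ≥ τ` of `ψ` (`exists_root_ge_of_twistSum_root`), read `ψ(ρ) = 0`
  as `|C_q| ρ^q ≥ |C_p| ρ^p + |C_r| ρ^r − ∑_L |C_l| ρ^l ≥ (1 − ∑ w_l)|C_p| ρ^p + |C_r| ρ^r`, and finish with weighted AM–GM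
  (`Census.amgm_pow_nat`).  The mirror family (HIGH exponents untwisted, window below) is the same statement for
  `X^{deg} f(1/X)`.
* `end_window_det_pencil` — the same for `det` of a census pencil `∑ X^{d l} • S l`, the form box certificates instantiate.

Nothing here bears on `ζ_sym`, on `DoorA26`/`DoorA34` (OPEN), on the crux `MatrixDescartes` (stmt-ValiantsHypothesis-18050) or
on `VP ≠ VNP`.

[folklore] Rolle's theorem, Descartes' rule of signs (sparse form), weighted AM–GM; elementary.
-/

-- `Summit.ValiantsHypothesis.ValiantsHypothesis.…` repeats a component by the D-0017 layout
-- (single-conjunct summit), which the `dupNamespace` linter flags; the name is mandated.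
set_option linter.dupNamespace false

namespace Summit.ValiantsHypothesis.ValiantsHypothesis.Theorems.LacunarySymmetroidMatrixDescartes.Census

open Polynomial Finset
open scoped BigOperators Polynomial

/-! ## The end-window row -/

/-- **THE END-WINDOW ROW** (coefficient/support form).  Let the real polynomial `f` be Descartes-sharp on its own support
(`#supp f ≤ #Z₊(f) + 1`), `L ⊆ supp f` a set of LOW exponents, `p < q < r` exponents of `f` above `L`, and
`U = ((supp f ∖ L) ∖ {p,q,r})` the remaining exponents; put `C_s = coeff f s · ∏_{u∈U}(s − u)` (the coefficients after the
exponents in `U` have been killed by Euler twists), `κ_s = ∏_{l∈L}(s − l)`, `a = q − p`, `b = r − q`.  Assume the window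
coefficients alternate (`C_p C_q < 0`, `C_q C_r < 0`) and that for weights `w_l ≥ 0` (`l ∈ L`) with `∑ w_l ≤ 1` the monomial
inequalities `|C_l|^b · ((a+b)|C_r| κ_r)^{p−l} ≤ w_l^b · |C_p|^b · (a|C_q| κ_q)^{p−l}` hold.  Then
`(a+b)^{a+b} · ((1 − ∑ w_l)|C_p|)^b · |C_r|^a ≤ |C_q|^{a+b} · a^a · b^b`.
For `L = ∅` this is the Newton-cone row C25 of the tree (`newton_cone_coeff`, trinomial form); for `L ≠ ∅` the twist factors of
the low exponents are absent (the row is STRONGER, `ln κ` being concave) at the price of `(1 − ∑ w_l)^b` — theory g20's «untwisting /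
end-window row» (input β), here an exact statement about every Descartes-sharp fewnomial. [folklore] -/
theorem end_window_coeff (f : ℝ[X])
    (hZ : f.support.card ≤ (f.roots.toFinset.filter (fun x => 0 < x)).card + 1)
    (L : Finset ℕ) {p q r : ℕ} (hp : p ∈ f.support) (hq : q ∈ f.support) (hr : r ∈ f.support)
    (hpq : p < q) (hqr : q < r) (hL : L ⊆ f.support) (hLp : ∀ l ∈ L, l < p)
    (U : Finset ℕ) (hU : U = (((f.support \ L).erase p).erase q).erase r)
    (Cf : ℕ → ℝ) (hCf : ∀ s, Cf s = f.coeff s * ∏ u ∈ U, ((s : ℝ) - u))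
    (hspq : Cf p * Cf q < 0) (hsqr : Cf q * Cf r < 0)
    (w : ℕ → ℝ) (hw0 : ∀ l ∈ L, 0 ≤ w l) (hw1 : ∑ l ∈ L, w l ≤ 1)
    (hwl : ∀ l ∈ L, |Cf l| ^ (r - q) * ((((r : ℝ) - p)) * |Cf r| * ∏ i ∈ L, ((r : ℝ) - i)) ^ (p - l)
        ≤ (w l) ^ (r - q) * |Cf p| ^ (r - q) * ((((q : ℝ) - p)) * |Cf q| * ∏ i ∈ L, ((q : ℝ) - i)) ^ (p - l)) :
    (((r : ℝ) - p)) ^ (r - p) * ((1 - ∑ l ∈ L, w l) * |Cf p|) ^ (r - q) * |Cf r| ^ (q - p)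
      ≤ |Cf q| ^ (r - p) * (((q : ℝ) - p)) ^ (q - p) * (((r : ℝ) - q)) ^ (r - q) := by
  classical
  -- exponent gaps
  obtain ⟨a, rfl⟩ : ∃ a, q = p + a := ⟨q - p, by omega⟩
  obtain ⟨b, rfl⟩ : ∃ b, r = p + a + b := ⟨r - (p + a), by omega⟩
  have ha : 0 < a := by omega
  have hb : 0 < b := by omega
  have e1 : p + a + b - (p + a) = b := by omega
  have e2 : p + a - p = a := by omega
  have e3 : p + a + b - p = a + b := by omega
  have c1 : ((p + a + b : ℕ) : ℝ) - (p : ℕ) = (a : ℝ) + b := by push_cast; ring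
  have c2 : ((p + a : ℕ) : ℝ) - (p : ℕ) = (a : ℝ) := by push_cast; ring
  have c3 : ((p + a + b : ℕ) : ℝ) - ((p + a : ℕ) : ℝ) = (b : ℝ) := by push_cast; ring
  simp only [e1, e2, e3, c1, c2, c3] at hwl ⊢
  -- names
  set S := f.support with hS
  set K : Finset ℕ := insert p (insert (p + a) (insert (p + a + b) L)) with hK
  have hpL : p ∉ L := fun h => lt_irrefl p (hLp p h)
  have hqL : p + a ∉ L := fun h => by have := hLp _ h; omega
  have hrL : p + a + b ∉ L := fun h => by have := hLp _ h; omega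
  have hKS : K ⊆ S := by
    intro s hs
    simp only [hK, Finset.mem_insert] at hs
    rcases hs with rfl | rfl | rfl | hs
    · exact hp
    · exact hq
    · exact hr
    · exact hL hs
  have hUSK : U = S \ K := by
    ext s
    simp only [hU, hK, Finset.mem_erase, Finset.mem_sdiff, Finset.mem_insert, not_or]
    tauto
  have hSU : S \ U = K := by
    rw [hUSK, Finset.sdiff_sdiff_eq_self hKS]
  have hKcard : K.card = L.card + 3 := by
    rw [hK, Finset.card_insert_of_notMem, Finset.card_insert_of_notMem, Finset.card_insert_of_notMem hrL]
    · simp only [Finset.mem_insert, not_or]; exact ⟨by omega, hqL⟩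
    · simp only [Finset.mem_insert, not_or]; exact ⟨by omega, by omega, hpL⟩
  have hUcard : U.card + (L.card + 3) = S.card := by
    rw [hUSK, Finset.card_sdiff_of_subset hKS, hKcard]
    have := Finset.card_le_card hKS; rw [hKcard] at this; omega
  -- the `U`-twisted polynomial `ψ`
  set ψ : ℝ[X] := ∑ s ∈ S, C (f.coeff s * ∏ u ∈ U, ((s : ℝ) - u)) * X ^ s with hψ
  have hψsupp : ψ.support = K := by rw [hψ, support_twistSum, hSU]
  have hψroots : L.card + 2 ≤ (ψ.roots.toFinset.filter (fun x => 0 < x)).card := by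
    have h := card_posRoots_le_card_posRoots_twistSum f U
    rw [← hψ] at h
    omega
  have hψZ : ψ.support.card ≤ (ψ.roots.toFinset.filter (fun x => 0 < x)).card + 1 := by
    rw [hψsupp, hKcard]; omega
  have hψcoeff : ∀ s, ψ.coeff s = Cf s := fun s => by rw [hψ, coeff_twistSum, hCf]
  have hLψ : L ⊆ ψ.support := by
    rw [hψsupp, hK]; intro l hl; simp [hl]
  have hL2 : L.card + 2 ≤ ψ.support.card := by rw [hψsupp, hKcard]; omega
  -- the `L`-twisted trinomial `V`
  set V : ℝ[X] := ∑ s ∈ ψ.support, C (ψ.coeff s * ∏ u ∈ L, ((s : ℝ) - u)) * X ^ s with hVdef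
  have hκpos : ∀ s, p ≤ s → 0 < ∏ i ∈ L, ((s : ℝ) - i) := fun s hs =>
    Finset.prod_pos fun i hi => by
      have := hLp i hi
      have : (i : ℝ) < s := by exact_mod_cast (by omega : i < s)
      linarith
  set κq := ∏ i ∈ L, (((p + a : ℕ) : ℝ) - i) with hκq
  set κr := ∏ i ∈ L, (((p + a + b : ℕ) : ℝ) - i) with hκr
  set κp := ∏ i ∈ L, (((p : ℕ) : ℝ) - i) with hκp
  have hκq0 : 0 < κq := hκpos _ (by omega)
  have hκr0 : 0 < κr := hκpos _ (by omega)
  have hVsupp : V.support = {p, p + a, p + a + b} := by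
    rw [hVdef, support_twistSum, hψsupp, hK]
    ext s
    simp only [Finset.mem_sdiff, Finset.mem_insert, Finset.mem_singleton]
    constructor
    · rintro ⟨h1, h2⟩; tauto
    · rintro (rfl | rfl | rfl)
      · exact ⟨Or.inl rfl, hpL⟩
      · exact ⟨Or.inr (Or.inl rfl), hqL⟩
      · exact ⟨Or.inr (Or.inr (Or.inl rfl)), hrL⟩
  have hVcoeff : ∀ s, V.coeff s = Cf s * ∏ u ∈ L, ((s : ℝ) - u) := fun s => by
    rw [hVdef, coeff_twistSum, hψcoeff]
  have hVeq : V = C (Cf p * κp) * X ^ p + C (Cf (p + a) * κq) * X ^ (p + a)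
      + C (Cf (p + a + b) * κr) * X ^ (p + a + b) := by
    have h := V.as_sum_support_C_mul_X_pow
    rw [hVsupp, Finset.sum_insert, Finset.sum_insert, Finset.sum_singleton, hVcoeff, hVcoeff, hVcoeff] at h
    · rw [h]; ring
    · simp only [Finset.mem_singleton]; omega
    · simp only [Finset.mem_insert, Finset.mem_singleton, not_or]; exact ⟨by omega, by omega⟩
  have hVroots : 1 < ((C (Cf p * κp) * X ^ p + C (Cf (p + a) * κq) * X ^ (p + a)
      + C (Cf (p + a + b) * κr) * X ^ (p + a + b)).roots.toFinset.filter (fun x => 0 < x)).card := by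
    rw [← hVeq]
    have h := card_posRoots_le_card_posRoots_twistSum ψ L
    rw [← hVdef] at h
    omega
  -- signs
  have hCq0 : Cf (p + a) ≠ 0 := fun h => by rw [h, mul_zero] at hspq; exact lt_irrefl _ hspq
  have hCr0 : Cf (p + a + b) ≠ 0 := fun h => by rw [h, mul_zero] at hsqr; exact lt_irrefl _ hsqr
  have hCp0 : Cf p ≠ 0 := fun h => by rw [h, zero_mul] at hspq; exact lt_irrefl _ hspq
  have hpr : 0 < Cf p * Cf (p + a + b) := by
    have h1 : 0 < (Cf p * Cf (p + a)) * (Cf (p + a) * Cf (p + a + b)) := mul_pos_of_neg_of_neg hspq hsqr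
    have h2 : (Cf p * Cf (p + a)) * (Cf (p + a) * Cf (p + a + b)) = (Cf p * Cf (p + a + b)) * Cf (p + a) ^ 2 := by ring
    rw [h2] at h1
    have hsq : 0 < Cf (p + a) ^ 2 := by positivity
    exact (mul_pos_iff_of_pos_right hsq).mp h1
  -- a root `τ` of `V` beyond the critical point, lifted to a root `ρ ≥ τ` of `ψ`
  obtain ⟨τ, hτ0, hτroot, hτ⟩ := exists_root_of_trinomial_pow_gt ha hb (Cf p * κp) (Cf (p + a) * κq)
    (Cf (p + a + b) * κr) (mul_ne_zero hCr0 hκr0.ne') hVroots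
  rw [← hVeq] at hτroot
  obtain ⟨ρ, hτρ, hρ0, hρroot⟩ := exists_root_ge_of_twistSum_root ψ hψZ L hLψ hL2 hτ0 hτroot
  -- `Θn := a |C_q| κ_q ≤ Θd ρ^b`, `Θd := (a+b) |C_r| κ_r`
  set Θn := (a : ℝ) * |Cf (p + a)| * κq with hΘn
  set Θd := ((a : ℝ) + b) * |Cf (p + a + b)| * κr with hΘd
  have hΘn0 : 0 ≤ Θn := by positivity
  have hΘd0 : 0 < Θd := by have := abs_pos.mpr hCr0; positivity
  have hΘ : Θn ≤ Θd * ρ ^ b := by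
    rw [abs_mul, abs_of_pos hκq0, abs_mul, abs_of_pos hκr0] at hτ
    have hρb : τ ^ b ≤ ρ ^ b := pow_le_pow_left₀ hτ0.le hτρ b
    have := mul_le_mul_of_nonneg_left hρb hΘd0.le
    nlinarith
  -- per low exponent: `|C_l| ρ^l ≤ w_l |C_p| ρ^p`
  have hlow : ∀ l ∈ L, |Cf l| * ρ ^ l ≤ w l * |Cf p| * ρ ^ p := by
    intro l hl
    have hlp : l < p := hLp l hl
    have hm : p - l + l = p := by omega
    have h := hwl l hl
    have hw0l := hw0 l hl
    have step1 : (w l) ^ b * |Cf p| ^ b * Θn ^ (p - l) ≤ (w l) ^ b * |Cf p| ^ b * (Θd * ρ ^ b) ^ (p - l) :=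
      mul_le_mul_of_nonneg_left (pow_le_pow_left₀ hΘn0 hΘ _) (by positivity)
    have step2 : |Cf l| ^ b * Θd ^ (p - l) ≤ (w l * |Cf p| * ρ ^ (p - l)) ^ b * Θd ^ (p - l) := by
      calc |Cf l| ^ b * Θd ^ (p - l) ≤ (w l) ^ b * |Cf p| ^ b * (Θd * ρ ^ b) ^ (p - l) := h.trans step1
        _ = (w l * |Cf p| * ρ ^ (p - l)) ^ b * Θd ^ (p - l) := by ring
    have step3 : |Cf l| ^ b ≤ (w l * |Cf p| * ρ ^ (p - l)) ^ b :=
      le_of_mul_le_mul_right step2 (pow_pos hΘd0 _)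
    have step4 : |Cf l| ≤ w l * |Cf p| * ρ ^ (p - l) :=
      (pow_le_pow_iff_left₀ (abs_nonneg _) (by positivity) hb.ne').mp step3
    calc |Cf l| * ρ ^ l ≤ (w l * |Cf p| * ρ ^ (p - l)) * ρ ^ l := mul_le_mul_of_nonneg_right step4 (by positivity)
      _ = w l * |Cf p| * ρ ^ p := by rw [mul_assoc, ← pow_add, hm]
  have hlowsum : ∑ l ∈ L, |Cf l| * ρ ^ l ≤ (∑ l ∈ L, w l) * (|Cf p| * ρ ^ p) := by
    rw [Finset.sum_mul]
    exact Finset.sum_le_sum fun l hl => by rw [← mul_assoc]; exact hlow l hl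
  -- `ψ(ρ) = 0` read on `K = {p, q, r} ∪ L`
  have heval : ψ.eval ρ = ∑ s ∈ S, Cf s * ρ ^ s := by
    rw [hψ, eval_finsetSum]
    refine Finset.sum_congr rfl fun s _ => ?_
    rw [eval_mul, eval_C, eval_pow, eval_X, hCf]
  have hzeroU : ∀ s ∈ S, s ∉ K → Cf s * ρ ^ s = 0 := by
    intro s hs hsK
    have hsU : s ∈ U := by rw [hUSK, Finset.mem_sdiff]; exact ⟨hs, hsK⟩
    rw [hCf, Finset.prod_eq_zero hsU (sub_self _), mul_zero, zero_mul]
  have hsumK : ∑ s ∈ K, Cf s * ρ ^ s = 0 := by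
    rw [Finset.sum_subset hKS hzeroU, ← heval, hρroot]
  have hsumK' : Cf p * ρ ^ p + (Cf (p + a) * ρ ^ (p + a) + (Cf (p + a + b) * ρ ^ (p + a + b)
      + ∑ l ∈ L, Cf l * ρ ^ l)) = 0 := by
    rw [hK, Finset.sum_insert, Finset.sum_insert, Finset.sum_insert hrL] at hsumK
    · exact hsumK
    · simp only [Finset.mem_insert, not_or]; exact ⟨by omega, hqL⟩
    · simp only [Finset.mem_insert, not_or]; exact ⟨by omega, by omega, hpL⟩
  -- |C_q| ρ^q ≥ (1 − ∑ w)|C_p| ρ^p + |C_r| ρ^r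
  have hΛ : |∑ l ∈ L, Cf l * ρ ^ l| ≤ ∑ l ∈ L, |Cf l| * ρ ^ l := by
    refine (Finset.abs_sum_le_sum_abs _ _).trans (le_of_eq (Finset.sum_congr rfl fun l _ => ?_))
    rw [abs_mul, abs_of_nonneg (pow_nonneg hρ0.le _)]
  have hsame : |Cf p * ρ ^ p + Cf (p + a + b) * ρ ^ (p + a + b)|
      = |Cf p| * ρ ^ p + |Cf (p + a + b)| * ρ ^ (p + a + b) := by
    have hprod : 0 ≤ (Cf p * ρ ^ p) * (Cf (p + a + b) * ρ ^ (p + a + b)) := by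
      have : (Cf p * ρ ^ p) * (Cf (p + a + b) * ρ ^ (p + a + b))
          = (Cf p * Cf (p + a + b)) * (ρ ^ p * ρ ^ (p + a + b)) := by ring
      rw [this]; positivity
    rw [(abs_add_eq_add_abs_iff _ _).mpr (mul_nonneg_iff.mp hprod), abs_mul, abs_mul,
      abs_of_nonneg (pow_nonneg hρ0.le _), abs_of_nonneg (pow_nonneg hρ0.le _)]
  have hq1 : |Cf (p + a)| * ρ ^ (p + a)
      = |(Cf p * ρ ^ p + Cf (p + a + b) * ρ ^ (p + a + b)) + ∑ l ∈ L, Cf l * ρ ^ l| := by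
    rw [← abs_of_nonneg (pow_nonneg hρ0.le (p + a)), ← abs_mul,
      show Cf (p + a) * ρ ^ (p + a)
        = -((Cf p * ρ ^ p + Cf (p + a + b) * ρ ^ (p + a + b)) + ∑ l ∈ L, Cf l * ρ ^ l) by linarith,
      abs_neg]
  have hq2 : (1 - ∑ l ∈ L, w l) * |Cf p| * ρ ^ p + |Cf (p + a + b)| * ρ ^ (p + a + b)
      ≤ |Cf (p + a)| * ρ ^ (p + a) := by
    rw [hq1]
    have t1 : |Cf p * ρ ^ p + Cf (p + a + b) * ρ ^ (p + a + b)|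
        ≤ |(Cf p * ρ ^ p + Cf (p + a + b) * ρ ^ (p + a + b)) + ∑ l ∈ L, Cf l * ρ ^ l|
          + |∑ l ∈ L, Cf l * ρ ^ l| := by
      simpa using abs_sub ((Cf p * ρ ^ p + Cf (p + a + b) * ρ ^ (p + a + b)) + ∑ l ∈ L, Cf l * ρ ^ l)
        (∑ l ∈ L, Cf l * ρ ^ l)
    rw [hsame] at t1
    have e : (1 - ∑ l ∈ L, w l) * |Cf p| * ρ ^ p = |Cf p| * ρ ^ p - (∑ l ∈ L, w l) * (|Cf p| * ρ ^ p) := by ring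
    rw [e]
    linarith [t1, hΛ, hlowsum]
  -- weighted AM–GM
  have hPnn : 0 ≤ (1 - ∑ l ∈ L, w l) * |Cf p| * ρ ^ p :=
    mul_nonneg (mul_nonneg (sub_nonneg.mpr hw1) (abs_nonneg _)) (pow_nonneg hρ0.le _)
  have hQnn : 0 ≤ |Cf (p + a + b)| * ρ ^ (p + a + b) := by positivity
  have amgm := amgm_pow_nat ha hb hPnn hQnn
  have hup : ((1 - ∑ l ∈ L, w l) * |Cf p| * ρ ^ p + |Cf (p + a + b)| * ρ ^ (p + a + b)) ^ (a + b)
      ≤ (|Cf (p + a)| * ρ ^ (p + a)) ^ (a + b) := pow_le_pow_left₀ (by positivity) hq2 _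
  have hfac : (0 : ℝ) ≤ (a : ℝ) ^ a * (b : ℝ) ^ b := by positivity
  set σ : ℝ := 1 - ∑ l ∈ L, w l with hσ
  have key : ((a : ℝ) + b) ^ (a + b) * (σ * |Cf p|) ^ b * |Cf (p + a + b)| ^ a
        * ρ ^ ((p + a) * (a + b))
      ≤ |Cf (p + a)| ^ (a + b) * (a : ℝ) ^ a * (b : ℝ) ^ b * ρ ^ ((p + a) * (a + b)) :=
    calc ((a : ℝ) + b) ^ (a + b) * (σ * |Cf p|) ^ b * |Cf (p + a + b)| ^ a
          * ρ ^ ((p + a) * (a + b))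
        = ((a : ℝ) + b) ^ (a + b) * (σ * |Cf p| * ρ ^ p) ^ b
            * (|Cf (p + a + b)| * ρ ^ (p + a + b)) ^ a := by ring
      _ ≤ (σ * |Cf p| * ρ ^ p + |Cf (p + a + b)| * ρ ^ (p + a + b)) ^ (a + b)
            * (a : ℝ) ^ a * (b : ℝ) ^ b := amgm
      _ = (σ * |Cf p| * ρ ^ p + |Cf (p + a + b)| * ρ ^ (p + a + b)) ^ (a + b)
            * ((a : ℝ) ^ a * (b : ℝ) ^ b) := by ring
      _ ≤ (|Cf (p + a)| * ρ ^ (p + a)) ^ (a + b) * ((a : ℝ) ^ a * (b : ℝ) ^ b) :=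
          mul_le_mul_of_nonneg_right hup hfac
      _ = |Cf (p + a)| ^ (a + b) * (a : ℝ) ^ a * (b : ℝ) ^ b * ρ ^ ((p + a) * (a + b)) := by ring
  exact le_of_mul_le_mul_right key (pow_pos hρ0 _)

/-- **The end-window row for census pencils.**  The determinant of a lacunary pencil `F = ∑ X^{d l} • S l` (ANY real
`m × m` matrices) with at least `#(m-fold sumset of d) − 1` distinct positive roots — Descartes-sharp at support resolution,
e.g. a HYPOTHETICAL `(2,6)` twenty on a Sidon support — satisfies every end-window row of `end_window_coeff`; this is the form
the cell's box certificates instantiate (support, coefficients and all gap products become numerals there). [folklore] -/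
theorem end_window_det_pencil {K m : ℕ} (d : Fin K → ℕ) (S : Fin K → Matrix (Fin m) (Fin m) ℝ)
    (hZ : ((Finset.univ : Finset (Fin m → Fin K)).image (fun g => ∑ i, d (g i))).card ≤
      ((Matrix.det (∑ l, ((X : ℝ[X]) ^ d l) • (S l).map C)).roots.toFinset.filter
        (fun t => 0 < t)).card + 1)
    (L : Finset ℕ) {p q r : ℕ}
    (hp : p ∈ (Matrix.det (∑ l, ((X : ℝ[X]) ^ d l) • (S l).map C)).support)
    (hq : q ∈ (Matrix.det (∑ l, ((X : ℝ[X]) ^ d l) • (S l).map C)).support)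
    (hr : r ∈ (Matrix.det (∑ l, ((X : ℝ[X]) ^ d l) • (S l).map C)).support)
    (hpq : p < q) (hqr : q < r) (hL : L ⊆ (Matrix.det (∑ l, ((X : ℝ[X]) ^ d l) • (S l).map C)).support)
    (hLp : ∀ l ∈ L, l < p) (U : Finset ℕ)
    (hU : U = ((((Matrix.det (∑ l, ((X : ℝ[X]) ^ d l) • (S l).map C)).support \ L).erase p).erase q).erase r)
    (Cf : ℕ → ℝ)
    (hCf : ∀ s, Cf s = (Matrix.det (∑ l, ((X : ℝ[X]) ^ d l) • (S l).map C)).coeff s * ∏ u ∈ U, ((s : ℝ) - u))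
    (hspq : Cf p * Cf q < 0) (hsqr : Cf q * Cf r < 0)
    (w : ℕ → ℝ) (hw0 : ∀ l ∈ L, 0 ≤ w l) (hw1 : ∑ l ∈ L, w l ≤ 1)
    (hwl : ∀ l ∈ L, |Cf l| ^ (r - q) * ((((r : ℝ) - p)) * |Cf r| * ∏ i ∈ L, ((r : ℝ) - i)) ^ (p - l)
        ≤ (w l) ^ (r - q) * |Cf p| ^ (r - q) * ((((q : ℝ) - p)) * |Cf q| * ∏ i ∈ L, ((q : ℝ) - i)) ^ (p - l)) :
    (((r : ℝ) - p)) ^ (r - p) * ((1 - ∑ l ∈ L, w l) * |Cf p|) ^ (r - q) * |Cf r| ^ (q - p)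
      ≤ |Cf q| ^ (r - p) * (((q : ℝ) - p)) ^ (q - p) * (((r : ℝ) - q)) ^ (r - q) :=
  end_window_coeff _ ((Finset.card_le_card (support_det_pencil_subset_sumset d S)).trans hZ) L hp hq hr hpq hqr
    hL hLp U hU Cf hCf hspq hsqr w hw0 hw1 hwl

end Summit.ValiantsHypothesis.ValiantsHypothesis.Theorems.LacunarySymmetroidMatrixDescartes.Census
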